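import Summits.CriticalPhenomena.SAWScalingLimit.Theorems.HexObservableLimitR.Negative.Mirror
import Literature.Probability.RandomPlanarGeometry.HexParafermionProofs

/-!
# Negative knowledge on crux `HexObservableLimitR` (stmt-CriticalPhenomena-14003), mirror part 2:
the reflection NEGATES windings of lattice polylines

The signed turning angle `turning z₁ z₂ z₃ = arg ((z₃ - z₂)/(z₂ - z₁))` changes sign under the reflection
`τ z = -conj z` as soon as the two increments are not parallel (`turning_τ`; for parallel increments `arg`
could be `π`, which is its own negative modulo `2π` but not in `ℝ`).  Along a path of the embedded honeycomb
lattice without immediate returns consecutive increments are never parallel (`cross_hexCenter_ne_zero`: the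
three edge directions at a vertex are pairwise independent — an integer computation in the coordinates
`2·re = j + r + 1`, `(6/√3)·im = 3r + (j mod 2) + 1` of `hexCenter (fj j r)`), so the winding of the reflected
vertex polyline is the negative of the original one (`winding_map_τ_of_path`).  Used by `MirrorSAW.lean`.
Everything proved. [folklore]
-/

noncomputable section

open Set Complex
open Literature.Probability.RandomPlanarGeometry
open Literature.Probability.LatticeModels Literature.Probability.RandomPlanarGeometry.SAW

namespace Summit.CriticalPhenomena.SAWScalingLimit.Theorems.HexObservableLimitR.Negative

open BoundaryClosure.Negative

/-! ### The cross product and the turning angle under `τ` -/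

/-- The planar cross product of two complex numbers seen as vectors. [folklore] -/
def cross (d d' : ℂ) : ℝ := d.re * d'.im - d.im * d'.re

/-- The imaginary part of a quotient is the cross product over the squared norm. [folklore] -/
theorem im_div_eq_cross (d d' : ℂ) : (d' / d).im = cross d d' / Complex.normSq d := by
  rw [Complex.div_im, cross]; ring

/-- A quotient with non-parallel numerator and denominator has argument `≠ π`. [folklore] -/
theorem arg_div_ne_pi {d d' : ℂ} (h : cross d d' ≠ 0) : Complex.arg (d' / d) ≠ Real.pi := by
  intro hpi
  have him := (Complex.arg_eq_pi_iff.1 hpi).2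
  rw [im_div_eq_cross] at him
  rcases div_eq_zero_iff.1 him with h1 | h2
  · exact h h1
  · have hd : d = 0 := Complex.normSq_eq_zero.1 h2
    apply h; simp [cross, hd]

/-- **The turning angle changes sign under the reflection** (non-parallel increments). [folklore] -/
theorem turning_τ {a b c : ℂ} (h : cross (b - a) (c - b) ≠ 0) :
    turning (τ a) (τ b) (τ c) = -turning a b c := by
  unfold turning
  have e : (τ c - τ b) / (τ b - τ a) = (starRingEnd ℂ) ((c - b) / (b - a)) := by
    rw [← τ_sub, ← τ_sub, τ, τ, neg_div_neg_eq, map_div₀]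
  rw [e, Complex.arg_conj, if_neg (arg_div_ne_pi h)]

/-! ### Polylines without flat joints -/

/-- No three consecutive points have parallel increments. [folklore] -/
def NonFlat : List ℂ → Prop
  | a :: b :: c :: l => cross (b - a) (c - b) ≠ 0 ∧ NonFlat (b :: c :: l)
  | _ => True

/-- **The winding of the reflected polyline is the negative of the winding.** [folklore] -/
theorem winding_map_τ : ∀ (l : List ℂ), NonFlat l →
    Literature.Probability.LatticeModels.winding (l.map τ) = -Literature.Probability.LatticeModels.winding l
  | [], _ => by simp
  | [_], _ => by simp
  | [_, _], _ => by simp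
  | a :: b :: c :: l, h => by
    have ih := winding_map_τ (b :: c :: l) h.2
    simp only [List.map_cons] at ih ⊢
    rw [winding_cons_cons_cons, winding_cons_cons_cons, turning_τ h.1, ih]
    ring

/-! ### Integer coordinates of face centres -/

/-- Twice the abscissa of a face: `P (fj j r) = j + r + 1`. [folklore] -/
def Pc (v : HexVertex) : ℤ := jOf v + rOf v + 1

/-- `(6/√3)` times the height of a face: `Q (fj j r) = 3r + (j mod 2) + 1`. [folklore] -/
def Qc (v : HexVertex) : ℤ := 3 * rOf v + jOf v % 2 + 1

/-- `Pc` in coordinates. [folklore] -/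
theorem Pc_fj (j r : ℤ) : Pc (fj j r) = j + r + 1 := by simp [Pc]
/-- `Qc` in coordinates. [folklore] -/
theorem Qc_fj (j r : ℤ) : Qc (fj j r) = 3 * r + j % 2 + 1 := by simp [Qc]

/-- The abscissa in integer coordinates. [folklore] -/
theorem re_hexCenter_eq (v : HexVertex) : (hexCenter v).re = (Pc v : ℝ) / 2 := by
  conv_lhs => rw [← fj_jOf_rOf v]
  rw [re_hexCenter_fj, Pc]; push_cast; ring

/-- The height in integer coordinates. [folklore] -/
theorem im_hexCenter_eq (v : HexVertex) : (hexCenter v).im = (Qc v : ℝ) * (Real.sqrt 3 / 6) := by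
  conv_lhs => rw [← fj_jOf_rOf v]
  rw [im_hexCenter_fj, Qc]; push_cast; ring

/-- The cross product of two lattice increments is `√3/12` times an integer. [folklore] -/
theorem cross_hexCenter_eq (u v w : HexVertex) :
    cross (hexCenter v - hexCenter u) (hexCenter w - hexCenter v) =
      (Real.sqrt 3 / 12) * (((Pc v - Pc u) * (Qc w - Qc v) - (Qc v - Qc u) * (Pc w - Pc v) : ℤ) : ℝ) := by
  rw [cross, Complex.sub_re, Complex.sub_im, Complex.sub_re, Complex.sub_im, re_hexCenter_eq,
    re_hexCenter_eq, re_hexCenter_eq, im_hexCenter_eq, im_hexCenter_eq, im_hexCenter_eq]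
  push_cast; ring

/-- The neighbours of `fj j r` by offset. [folklore] -/
theorem adj_fj_cases {j r : ℤ} {w : HexVertex} (h : hexGraph.Adj (fj j r) w) :
    w = fj (j + 1) r ∨ w = fj (j - 1) r ∨ (j % 2 = 0 ∧ w = fj (j + 1) (r - 1)) ∨ (j % 2 = 1 ∧ w = fj (j - 1) (r + 1)) := by
  rw [← fj_jOf_rOf w, adj_fj_iff] at h
  rw [← fj_jOf_rOf w]
  set j' := jOf w; set r' := rOf w
  simp only [fj_inj]
  omega

/-- **The integer cross product of two distinct edge directions at a vertex is non-zero.** [folklore] -/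
theorem crossInt_ne_zero {j r : ℤ} {u w : HexVertex} (hu : hexGraph.Adj (fj j r) u) (hw : hexGraph.Adj (fj j r) w)
    (huw : u ≠ w) :
    (Pc (fj j r) - Pc u) * (Qc w - Qc (fj j r)) - (Qc (fj j r) - Qc u) * (Pc w - Pc (fj j r)) ≠ 0 := by
  rcases adj_fj_cases hu with rfl | rfl | ⟨hj, rfl⟩ | ⟨hj, rfl⟩ <;>
  rcases adj_fj_cases hw with rfl | rfl | ⟨hj', rfl⟩ | ⟨hj', rfl⟩ <;>
  simp only [Pc_fj, Qc_fj, ne_eq, not_true_eq_false] at huw ⊢ <;>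
  ring_nf <;> omega

/-- **Consecutive increments of a honeycomb path without immediate return are not parallel.** [folklore] -/
theorem cross_hexCenter_ne_zero {u v w : HexVertex} (hu : hexGraph.Adj v u) (hw : hexGraph.Adj v w) (huw : u ≠ w) :
    cross (hexCenter v - hexCenter u) (hexCenter w - hexCenter v) ≠ 0 := by
  rw [cross_hexCenter_eq]
  refine mul_ne_zero (by positivity) ?_
  rw [← fj_jOf_rOf v] at hu hw ⊢
  exact_mod_cast crossInt_ne_zero hu hw huw

/-! ### Lattice paths -/

/-- No immediate returns `x → y → x` along a vertex list. [folklore] -/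
def NoReturn {V : Type*} : List V → Prop
  | x :: y :: z :: l => x ≠ z ∧ NoReturn (y :: z :: l)
  | _ => True

/-- The embedded polyline of a honeycomb path without immediate returns has no flat joints. [folklore] -/
theorem nonFlat_map_hexCenter : ∀ (P : List HexVertex), P.IsChain hexGraph.Adj → NoReturn P →
    NonFlat (P.map hexCenter)
  | [], _, _ => trivial
  | [_], _, _ => trivial
  | [_, _], _, _ => trivial
  | x :: y :: z :: l, hc, hn => by
    simp only [List.map_cons]
    refine ⟨?_, ?_⟩
    · have hxy : hexGraph.Adj x y := hc.rel
      have hyz : hexGraph.Adj y z := hc.tail.rel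
      exact cross_hexCenter_ne_zero hxy.symm hyz hn.1
    · have := nonFlat_map_hexCenter (y :: z :: l) (List.IsChain.tail hc) hn.2
      simpa only [List.map_cons] using this

/-- **Reflection negates the winding of an embedded honeycomb path without immediate returns.** [folklore] -/
theorem winding_map_τ_of_path (P : List HexVertex) (hc : P.IsChain hexGraph.Adj) (hn : NoReturn P) :
    Literature.Probability.LatticeModels.winding ((P.map hexCenter).map τ) =
      -Literature.Probability.LatticeModels.winding (P.map hexCenter) :=
  winding_map_τ _ (nonFlat_map_hexCenter P hc hn)

/-- The reflected path's embedded polyline is the reflection of the embedded polyline. [folklore] -/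
theorem map_hexCenter_map_σ (P : List HexVertex) : (P.map σ).map hexCenter = (P.map hexCenter).map τ := by
  rw [List.map_map, List.map_map]
  congr 1; funext v; exact hexCenter_σ v

end Summit.CriticalPhenomena.SAWScalingLimit.Theorems.HexObservableLimitR.Negative
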